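import Literature.NumberTheory.GaloisCohomology.ArchimedeanInvariantMap
import Literature.NumberTheory.GaloisCohomology.PoitouTate
import HarnessLib

/-!
# `H¹(K_w, M) = 0` at a complex place, and the archimedean representability hypothesis `harch`
# of the `S`-restricted `Ш`-pairing for a totally complex field

Theorems only (no definition, no named fact, no `sorry`, no instance, no notation).  Topic
`NumberTheory/GaloisCohomology`; namespace `Literature.NumberTheory.GaloisCohomology`.  Lane «PT-Ш-S-TC» of
cell `bsd-eis` (crux `GoodLatticeBDPValue`), brick D5c: the hypothesis `harch` of
`ShaReadout.pairing_perfect` / `ShaExtRoad.pairing_perfect` / `ShaExtRoadKit.natural_at_of_kit` ("every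
character of `H¹(K_w, M^D)` at an infinite place `w` is a local Tate pairing `x ↦ inv_w(t ∪ x)`") is VACUOUS for
`K` totally complex: every infinite place is complex, `Γ_{K_w} = Gal(ℂ/ℂ)` is trivial
(`eq_one_absoluteGaloisGroup_of_isComplex`), so `H¹(K_w, ·) = 0` (a continuous crossed homomorphism on the
trivial group vanishes: `φ(1) = 0`) and `t := 0` represents the (zero) character.

* `subsingleton_galoisCohomology_one_of_forall_eq_one` — `H¹(F, N) = 0` when `Γ_F` is trivial;
* `subsingleton_galoisCohomology_one_toLocal_inl_of_isComplex` — `H¹(K_w, M) = 0` at a complex place;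
* **`harch_of_isTotallyComplex`** — the `harch` hypothesis, for every `n`, `M`, local invariant family.

HONEST FRAMING: elementary; nothing about Poitou–Tate duality or BSD is proved here.  AI formalisation,
established only by the kernel check.

## References
* J.-P. Serre, *Galois Cohomology* (1997), I §2.4, I §5.1 (`H¹` by cocycles), II §6.3 (archimedean places).
  [SerreGaloisCohomology1997]
* J. S. Milne, *Arithmetic Duality Theorems*, 2nd ed. (2006), I Thm. 2.13 (a) and Thm. 4.10 (the archimedean
  factors for totally complex `K`). [MilneADT2006]
-/

noncomputable section

open NumberField IsDedekindDomain Field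
open scoped NumberField

namespace Literature.NumberTheory.GaloisCohomology

open Literature.NumberTheory.GaloisRepresentations
open Literature.NumberTheory.GaloisRepresentations.DiscreteGaloisModule (localTatePairingZMod)

/-- **`H¹(F, N) = 0` when the absolute Galois group of `F` is trivial**: a continuous crossed homomorphism
`φ` satisfies `φ(1) = 0` (`contOneCocycles.apply_one`), hence vanishes, hence its class is `0`.
[cite: SerreGaloisCohomology1997, I §5.1] -/
theorem subsingleton_galoisCohomology_one_of_forall_eq_one {F : Type} [Field F]
    (hF : ∀ σ : absoluteGaloisGroup F, σ = 1)
    {N : Type} [AddCommGroup N] [TopologicalSpace N] [DiscreteTopology N] (τ : DiscreteGaloisModule F N) :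
    Subsingleton (galoisCohomology τ 1) := by
  have hz : ∀ φ : contOneCocycles τ.toTopRep, oneCocycleClass τ.toTopRep φ = 0 := fun φ =>
    (oneCocycleClass_eq_zero_iff τ.toTopRep φ).2 ⟨0, fun g => by
      rw [hF g, contOneCocycles.apply_one, map_zero, sub_zero]⟩
  refine ⟨fun x y => ?_⟩
  obtain ⟨z, rfl⟩ := oneCocycleClass_surjective τ.toTopRep x
  obtain ⟨w, rfl⟩ := oneCocycleClass_surjective τ.toTopRep y
  rw [hz z, hz w]

variable {K : Type} [Field K] [NumberField K] {M : Type} [AddCommGroup M] [TopologicalSpace M]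
  [DiscreteTopology M]

/-- **`H¹(K_w, M) = 0` at a COMPLEX place `w`** (`Γ_{K_w}` is trivial).
[cite: SerreGaloisCohomology1997, I §2.4 and II §6.3] -/
theorem subsingleton_galoisCohomology_one_toLocal_inl_of_isComplex {w : InfinitePlace K} (hw : w.IsComplex)
    (ρ : DiscreteGaloisModule K M) : Subsingleton (galoisCohomology (ρ.toLocal (Sum.inl w)) 1) :=
  subsingleton_galoisCohomology_one_of_forall_eq_one (eq_one_absoluteGaloisGroup_of_isComplex hw) _

/-- **The archimedean representability hypothesis `harch` holds for a totally complex `K`** (vacuously: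
`H¹(K_w, M^D) = 0`, so every character of it is `x ↦ inv_w(0 ∪ x)`), for every level `n`, every finite
module and every family of local invariant maps. [cite: MilneADT2006, I Thm. 2.13 (a) and Thm. 4.10 (a)] -/
theorem harch_of_isTotallyComplex [IsTotallyComplex K] [Finite M] (ρ : DiscreteGaloisModule K M) (n : ℕ)
    (linv : LocalInvariants K n) (w : InfinitePlace K)
    (Φ : galoisCohomology ((ρ.tateDual n).toLocal (Sum.inl w)) 1 →+ ZMod n) :
    ∃ t : galoisCohomology (ρ.toLocal (Sum.inl w)) 1,
      ∀ x, Φ x = localTatePairingZMod ρ n (Sum.inl w) (linv (Sum.inl w)) t x := by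
  haveI := subsingleton_galoisCohomology_one_toLocal_inl_of_isComplex (IsTotallyComplex.isComplex w)
    (ρ.tateDual n)
  exact ⟨0, fun x => by rw [Subsingleton.elim x 0, map_zero, map_zero]⟩

end Literature.NumberTheory.GaloisCohomology

end
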